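import Summits.Ventures.CertifiedManyBodySolver.Rows.RectMarginalNodesGS
import HarnessLib

/-!
# Square-lattice window-marginal nodes — module 5/9: RectMarginalNodesTW

HONEST FRAMING: first certified bounds; not a superconductivity verdict; every number certified or labelled float.
SOUNDNESS / TRANSPORT statements only (inequalities between relaxations and finite-torus / thermodynamic-limit energies); no number is certified here.
THIS module: §6b TERM-WISE-RELOCATED ground-state stability rows on the window-marginal side: `TWDatum` (translation data) / `TWDatumD4` (affine-`D₄` data) with the relocation identity `sum_eq` as a FIELD, `TWDatum.row` / `row_rdm`, the class node `LTIRectGSNodeTW` + `.mono` / `.le_energyDensity2D` / `.m3EnergyLowerRow` / `.m2EnergyLowerRow`.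

FILING NOTE (sr-mbsolver-lit-4 g9, 2026-08-22): modules 5–9 `Rows/RectMarginalNodesTW.lean` → `…Sym.lean` → `…SymTorus.lean` → `…SymTransport.lean` → `…SymTL.lean`
continue parts 1–4 (`Rows/RectMarginalNodes.lean` … `Rows/RectMarginalNodesGS.lean`) and are sr-mbsolver-op-07 gen-12's PROVED HOME file
`HOME/sr-mbsolver-op-07/lean/RectMarginalNodes_v3.2.lean` (sha256 d4d4026ae96b32c5…, 2 279 lines, sorry-free, standard axioms; = v3.1 87fe4cef… with the §7.4 proof cut into
`IsSymTorusState` / `isSymTorusState_sectorGround` / `le_div_of_isSymTorusState`) §6b–§7 split per op-07's `FILING-MAP-v3.2.md` (one-writer rule; §8 not filed: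
content-duplicate of pub-hubbard #235 `HubbardAlg/GSWindowNodeD4Sound.lean`), namespace `…CertifiedManyBodySolver.Sketch2D` renamed `Summit.Ventures.CertifiedManyBodySolver.Rows.RectMarginalNodes`;
declarations, statements and proofs VERBATIM (9 one-line docstrings added for the gate's lint; modules 8/9 re-declare the §7.3 `variable {L : ℕ} [NeZero L]` and module 8
re-applies module 7's `DecidableEq (FermionTorus 2 L)` instance as a local instance of priority high (op-07 g13 advisories A1/A2 adopted: minimal imports, no pin in module 9).
-/

noncomputable section

open Matrix Complex Finset Filter Topology
open scoped ComplexOrder MatrixOrder BigOperators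
open Literature.Probability.LatticeModels
open Literature.MathematicalPhysics.QuantumLattice
open Literature.MathematicalPhysics.QuantumLattice.AndersonCluster
open Literature.MathematicalPhysics.QuantumLattice.HubbardWave0
open Literature.MathematicalPhysics.QuantumLattice.ThermodynamicLimit
open Literature.MathematicalPhysics.QuantumManyBody.StateRelaxation

namespace Summit.Ventures.CertifiedManyBodySolver.Rows.RectMarginalNodes

section TermWiseRows

/-! ## §6b  TERM-WISE-RELOCATED ground-state stability rows (hubbard-alg L2 `M3PLUS-SPEC-l2-idea-1.md` §4; l2-idea-1's
ask of 2026-08-22T07:25Z)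

§6's stability row for `(Λ, A)` needs the whole thickened support `Λ⁺ = thicken Λ 1 ⊆ W` (`W = 3×3` ⇒ `Λ` = the
centre site only; `W = 3×2` ⇒ nothing).  But `Ãᴴ[H_{Λ⁺}, Ã]` is a SUM of pieces (one per Hamiltonian term meeting
`Λ`, each supported on `Λ ∪ {one neighbour}`), and a translation-invariant state evaluates a piece equally well on
any TRANSLATE of its support: if every piece has a translate inside `W`, the stability inequality IS a linear row on
`ρ_W` ("term-wise embedding").  We type the relocation as a DATUM — `TWDatum t U W Λ A`: pieces `B_k ∈ 𝔄_{S_k}`,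
`S_k ⊆ Λ⁺`, translates `S_k + v_k ⊆ W`, and the algebraic identity `Σ_k Γ(B_k) = Ãᴴ[H_{Λ⁺}, Ã]` in `𝔄_{Λ⁺}` (the
identity is the certificate's obligation; the soundness proofs below use it as a black box) — with its row
`TWDatum.row ρ = Σ_k Tr(ρ · Γ(S_k + v_k ⊆ W)(τ_{v_k} B_k))`; the affine-`D₄` variant `TWDatumD4` (pieces relocated
by `x ↦ γ_k x + v_k`, for windows whose short side needs a rotation); the node `LTIRectGSNodeTW` (torus-limit
class: translations only, ANY box `Λ`, `A` commuting with `N_Λ`, `S^z_Λ`) with `le_energyDensity2D` PROVED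
(`TWDatum.row_rdm`: on the marginal of a TI state the relocated row equals `ω(Ãᴴ[H_{Λ⁺}, Ã])`, then
`IsTorusLimitOf.localStability`); and in §7 the symmetric BY-VALUE node `LTIRectSymGSNodeTW` (both data kinds,
boxes `Λ ⊆ W`, `A` commuting with `N_Λ` only) with `le_groundEnergyAt_div` / `le_energyDensity2D` PROVED. -/


/-- A TERM-WISE RELOCATION DATUM for the stability observable `Ãᴴ[H_{Λ⁺}, Ã]` of `(Λ, A)` in the window `W`
(translations): finitely many pieces `B k ∈ 𝔄_{S k}` on supports `S k ⊆ thicken Λ 1` which, embedded in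
`𝔄_{thicken Λ 1}`, SUM to `stabilityObs t U Λ A`, each with a translate `shiftSet (v k) (S k) ⊆ W`.  (The engine's
datum, M3PLUS-SPEC §4: one piece per Hamiltonian term meeting `Λ`, support `Λ ∪ {one neighbour}`.)
[cite: BratteliRobinsonII1997, Prop. 5.3.25] -/
structure TWDatum (t U : ℝ) (W Λ : Finset (Site 2)) (A : FermionOp Λ) where
  /-- the number of pieces -/
  m : ℕ
  /-- the supports of the pieces -/
  S : Fin m → Finset (Site 2)
  /-- the supports lie in the thickened box -/
  hS : ∀ k, S k ⊆ thicken Λ 1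
  /-- the pieces -/
  B : ∀ k, FermionOp (S k)
  /-- the relocating translations -/
  v : Fin m → Site 2
  /-- each translated support lies in the window -/
  hv : ∀ k, shiftSet (v k) (S k) ⊆ W
  /-- the pieces reassemble to the stability observable `Ãᴴ[H_{Λ⁺}, Ã]` -/
  sum_eq : ∑ k, fermionEmbed (PolySite.incl (hS k)) (B k) = stabilityObs t U Λ A

/-- The term-wise-relocated stability ROW of a translation datum on a window density matrix:
`Σ_k Tr(ρ_W · Γ(S_k + v_k ⊆ W)(τ_{v_k} B_k))`. -/
def TWDatum.row {t U : ℝ} {W Λ : Finset (Site 2)} {A : FermionOp Λ} (D : TWDatum t U W Λ A)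
    (ρ : FermionOp W) : ℂ :=
  ∑ k, (ρ * fermionEmbed ((PolySite.shiftEmb (D.v k) (D.S k)).trans (PolySite.incl (D.hv k))) (D.B k)).trace

/-- **KEY IDENTITY** (translation invariance, piece by piece): on the window marginal of a translation-invariant
state the relocated row IS `ω(Ãᴴ[H_{Λ⁺}, Ã])`. -/
theorem TWDatum.row_rdm {t U : ℝ} {W Λ : Finset (Site 2)} {A : FermionOp Λ} (D : TWDatum t U W Λ A)
    {ω : InfVolFermionState 2} (hω : ω.IsTranslationInvariant) :
    D.row (ω.rdm W) = ω.expect (thicken Λ 1) (stabilityObs t U Λ A) := by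
  unfold TWDatum.row
  rw [← D.sum_eq, map_sum]
  refine Finset.sum_congr rfl fun k _ => ?_
  rw [ω.trace_rdm_mul, ← fermionEmbed_fermionEmbed, ω.compatible (D.hv k), ← ω.shift_expect (D.v k) (D.S k) (D.B k),
    hω (D.v k), ω.compatible (D.hS k)]

/-- An AFFINE-`D₄` RELOCATION DATUM: as `TWDatum`, but piece `k` is relocated by the affine point-group map
`x ↦ γ_k x + v_k` (`PolySite.d4Emb`), for windows whose short side needs a rotation (M3PLUS-SPEC §4, `3×2`).  Sound
for the by-value symmetric node of §7 (it needs the `p4m` invariance of the witness state), not for the torus-limit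
class node. [cite: Han2020Bootstrap, §3] -/
structure TWDatumD4 (t U : ℝ) (W Λ : Finset (Site 2)) (A : FermionOp Λ) where
  /-- the number of pieces -/
  m : ℕ
  /-- the supports of the pieces -/
  S : Fin m → Finset (Site 2)
  /-- the supports lie in the thickened box -/
  hS : ∀ k, S k ⊆ thicken Λ 1
  /-- the pieces -/
  B : ∀ k, FermionOp (S k)
  /-- the relocating point-group elements -/
  γ : Fin m → DihedralGroup 4
  /-- the relocating translations -/
  v : Fin m → Site 2
  /-- each relocated support lies in the window -/
  hv : ∀ k, d4ShiftSet (γ k) (v k) (S k) ⊆ W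
  /-- the pieces reassemble to the stability observable `Ãᴴ[H_{Λ⁺}, Ã]` -/
  sum_eq : ∑ k, fermionEmbed (PolySite.incl (hS k)) (B k) = stabilityObs t U Λ A

/-- The term-wise-relocated stability ROW of an affine-`D₄` datum on a window density matrix. -/
def TWDatumD4.row {t U : ℝ} {W Λ : Finset (Site 2)} {A : FermionOp Λ} (D : TWDatumD4 t U W Λ A)
    (ρ : FermionOp W) : ℂ :=
  ∑ k, (ρ * fermionEmbed ((PolySite.d4Emb (D.γ k) (D.v k) (D.S k)).trans (PolySite.incl (D.hv k))) (D.B k)).trace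

/-- **The LTI rectangle-window node with density, spin-density and TERM-WISE-RELOCATED ground-state stability rows**
(translation data; any box `Λ`, any `A ∈ 𝔄_Λ` commuting with `N_Λ` and `S^z_Λ`); torus-limit class soundness below.
[cite: KullEtAl2024, §II.B] [cite: BratteliRobinsonII1997, Prop. 5.3.25] -/
def LTIRectGSNodeTW (t U : ℝ) (a b : ℕ) (n lo : ℝ) : Prop :=
  ∀ ρ : FermionOp (rectWindow a b), ρ.PosSemidef → ρ.trace = 1 → WindowLTI ρ →
    ((ρ * totalNumber).trace).re = ((a : ℝ) * b) * n →
    (∀ σ : Fin 2, ((ρ * ∑ y : PolySite (rectWindow a b), numberOp y σ).trace).re = ((a : ℝ) * b) * (n / 2)) →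
    (∀ (Λ : Finset (Site 2)) (A : FermionOp Λ), Commute A totalNumber → Commute A HubbardWave0.spinZ →
        ∀ D : TWDatum t U (rectWindow a b) Λ A, 0 ≤ D.row ρ) →
    lo ≤ ((ρ * hAvg t U a b).trace).re

/-- Monotonicity of the term-wise ground-state-class node in its bound. -/
theorem LTIRectGSNodeTW.mono {t U : ℝ} {a b : ℕ} {n lo lo' : ℝ} (h : LTIRectGSNodeTW t U a b n lo)
    (hlo : lo' ≤ lo) : LTIRectGSNodeTW t U a b n lo' :=
  fun ρ h1 h2 h3 h4 h5 h6 => hlo.trans (h ρ h1 h2 h3 h4 h5 h6)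

/-- Fewer rows: an `LTIRectNode` bound is an `LTIRectGSNodeTW` bound (so §5's dominance edges feed this node). -/
theorem LTIRectNode.gsNodeTW {t U : ℝ} {a b : ℕ} {n lo : ℝ} (h : LTIRectNode t U a b n lo) :
    LTIRectGSNodeTW t U a b n lo :=
  fun ρ h1 h2 h3 h4 _ _ => h ρ h1 h2 h3 h4

/-- **SOUNDNESS of the term-wise node in the thermodynamic limit** (`U ≥ 0`, `0 ≤ n < 2`, `a, b ≥ 2`): the window
marginal of a torus-limit ground-state-class witness satisfies every relocated row (`TWDatum.row_rdm` +
`IsTorusLimitOf.localStability`), and the rest is §6. -/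
theorem LTIRectGSNodeTW.le_energyDensity2D {t U : ℝ} (hU : 0 ≤ U) {a b : ℕ} (ha : 2 ≤ a) (hb : 2 ≤ b) {n lo : ℝ}
    (hn0 : 0 ≤ n) (hn2 : n < 2) (h : LTIRectGSNodeTW t U a b n lo) : lo ≤ energyDensity2D t U n := by
  refine le_energyDensity2D_of_forall_torusLimit t hU hn0 hn2 fun ω ψ Ls hLs hω hti _ _ hgs hd hspin => ?_
  have key := h (ω.rdm (rectWindow a b)) (ω.rdm_posSemidef _) (ω.trace_rdm _) (windowLTI_rdm hti _)
    (by rw [ω.trace_rdm_mul, hti.re_expect_totalNumber, card_rectWindow', hd])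
    (fun σ => by
      rw [ω.trace_rdm_mul, HubbardAlg.GSWindowNodeD4Sound.expect_sum_numberOp hti, hspin σ, ← Complex.ofReal_natCast, ← Complex.ofReal_mul,
        Complex.ofReal_re, card_rectWindow'])
    (fun Λ A hAN hAS D => by
      rw [D.row_rdm hti]
      exact InfVolFermionState.IsTorusLimitOf.localStability t U hω hLs hgs hAN hAS)
  rwa [ω.trace_rdm_mul, re_expect_hAvg hti ha hb] at key

/-- The `M3` cell (`U = 8`, `n = 7/8`, `t' = 0`) of a certified term-wise ground-state-class node. -/
theorem LTIRectGSNodeTW.m3EnergyLowerRow {a b : ℕ} (ha : 2 ≤ a) (hb : 2 ≤ b) {lo : ℚ}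
    (h : LTIRectGSNodeTW 1 8 a b (7 / 8) lo) : M3EnergyLowerRow 0 lo :=
  (M3EnergyLowerRow_zero_iff lo).2 (h.le_energyDensity2D (by norm_num) ha hb (by norm_num) (by norm_num))

/-- The `M2` cell (half filling) of a certified term-wise ground-state-class node. -/
theorem LTIRectGSNodeTW.m2EnergyLowerRow {U : ℝ} (hU : 0 ≤ U) {a b : ℕ} (ha : 2 ≤ a) (hb : 2 ≤ b) {lo : ℚ}
    (h : LTIRectGSNodeTW 1 U a b 1 lo) : M2EnergyLowerRow U lo :=
  h.le_energyDensity2D hU ha hb zero_le_one one_lt_two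

end TermWiseRows

end Summit.Ventures.CertifiedManyBodySolver.Rows.RectMarginalNodes

end
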